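import Literature.Probability.LatticeModels.PlusFreeComparison
import Literature.Probability.LatticeModels.PositiveFieldUniqueness
import Literature.Probability.LatticeModels.IsingTranslationInvariance
import HarnessLib

/-!
# IN A POSITIVE FIELD THE FREE AND PLUS STATES AGREE ON EVERY SPIN PRODUCT: `⟨σ_A⟩^∅_{β,h} = ⟨σ_A⟩⁺_{β,h}` (`h > 0`)
# (Friedli–Velenik 2017, Thm. 3.25 (1) / Thm. 3.28 (proof of 3 ⇒ 2), Lemma 3.19, Exercise 3.10; Lebowitz–Martin-Löf 1972)

Claimed R42 (8)(c) in the cell INBOX at 2026-08-29T01:14:38Z by fkp-10a gen 357 (NEW CLAIM #2 of the gen), addressed to coordinator fk-4 gen 288 (seated 01:00Z 2026-08-29 by l.8634; R160 = row FO-10a-g357); lineage row FO-10a-g357f (self-suggested), package g357-field, label HF-B.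
Helper file of the `fk-continuity` build cell (bschramm lane; `--supports stmt-CriticalPhenomena-4575`); builds on
p205010 (kernel theorem, internal audit signed; external expert review pending). No definitions, no named facts, no
sorries; standard axioms. UNCONDITIONAL (nearest-neighbour Ising model on `ℤ^d`, `d ≥ 1`, every `β ≥ 0`, `h > 0`).

The tree proves the one-point agreement `⟨σ_0⟩^∅_{β,h} = ⟨σ_0⟩⁺_{β,h}` for `h > 0`
(`freeCorr_eq_plusCorr_singleton_of_pos_holds`, `PositiveFieldUniqueness`: the GHS route of Friedli–Velenik Remark 3.41)
and, AT ZERO FIELD, the Lebowitz–Martin-Löf propagation "one-point agreement ⇒ agreement on all spin products"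
(`freeCorr_eq_plusCorr_of_spontaneousMagnetization_eq_zero`, `PlusFreeComparison`, by Holley domination of the
occupation indicators `n_A = ∏_{i∈A} (1+σ_i)/2` and of `Σ_{i∈A} n_i − n_A`, Friedli–Velenik Thm. 3.28, proof of 3 ⇒ 2).
Here the propagation is run AT FIELD `h ≥ 0` (the finite-volume Holley comparison
`isingExpect_free_le_plus_of_monotone` holds at every field) and combined with the one-point agreement at `h > 0`:

* `tendsto_isingExpect_free_plusIndicator_field`, `tendsto_isingExpect_plus_plusIndicator_field` — the box limits of
  `⟨n_B⟩^{∅/+}_{Λ_L;β,h}` (`β, h ≥ 0`);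
* `powersetSum_freeCorr_le_plusCorr_field`, `sum_sub_powersetSum_freeCorr_le_plusCorr_field` — Holley in the limit at
  field `h ≥ 0`: `⟨n_A⟩^∅_{β,h} ≤ ⟨n_A⟩⁺_{β,h}` and `⟨Σ_{i∈A} n_i − n_A⟩^∅_{β,h} ≤ ⟨Σ_{i∈A} n_i − n_A⟩⁺_{β,h}`;
* `freeCorr_singleton_eq_plusCorr_singleton_of_pos` — `⟨σ_x⟩^∅_{β,h} = ⟨σ_x⟩⁺_{β,h}` for every site `x` (`h > 0`;
  translation invariance of both states);
* **`freeCorr_eq_plusCorr_of_pos_field`** — **for `d ≥ 1`, `β ≥ 0`, `h > 0` and EVERY finite `A ⊆ ℤ^d`: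
  `⟨σ_A⟩^∅_{β,h} = ⟨σ_A⟩⁺_{β,h}`** (Möbius inversion over `A`); `powersetSum_freeCorr_eq_plusCorr_of_pos_field`
  (`⟨n_A⟩^∅ = ⟨n_A⟩⁺`);
* consequences: `freeCorr_pair_eq_plusCorr_pair_of_pos_field` (two-point functions), `freeTruncated_eq_plusTruncated_of_pos_field`
  (the truncated pair functions `⟨σ_{{x}∆{y}}⟩ − ⟨σ_x⟩⟨σ_y⟩` of the two states agree at `h > 0`).

## References

* S. Friedli, Y. Velenik, *Statistical Mechanics of Lattice Systems*, CUP (2017), Lemma 3.19, Exercise 3.10, Thm. 3.25 (1),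
  Thm. 3.28 (proof of 3 ⇒ 2), Remark 3.41, Thm. 3.17, Exercise 3.16. [FriedliVelenik2017]
* J. L. Lebowitz, A. Martin-Löf, *On the uniqueness of the equilibrium state for Ising spin systems*, Comm. Math. Phys. 25
  (1972) 276–282, Theorem. [LebowitzMartinlof1972]
-/

noncomputable section

namespace Summit.CriticalPhenomena.PercolationContinuityZ3.Theorems.FK

namespace IsingSusceptibility

open MeasureTheory Filter Topology Finset Set
open scoped symmDiff
open Literature.Probability.LatticeModels

variable {d : ℕ}

/-! ### Box limits of the occupation indicators at field `h ≥ 0` -/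

/-- The box limit of `⟨n_B⟩^∅_{Λ(L);β,h}` is `2^{-|B|} Σ_{D⊆B} ⟨σ_D⟩^∅_{β,h}` (`β, h ≥ 0`).
[cite: FriedliVelenik2017, Lemma 3.19 and Exercise 3.16] -/
theorem tendsto_isingExpect_free_plusIndicator_field {β h : ℝ} (hβ : 0 ≤ β) (hh : 0 ≤ h) (B : Finset (Site d)) :
    Tendsto (fun L : ℕ => isingExpect (zdGraph d) (box d L) β h .free (plusIndicator B)) atTop
      (𝓝 (((2 : ℝ) ^ #B)⁻¹ * ∑ D ∈ B.powerset, freeCorr d β h D)) := by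
  simp only [isingExpect_plusIndicator]
  exact (tendsto_finsetSum _ fun D _ => hasBoxLimit_isingCorr_free_holds (d := d) hβ hh D).const_mul _

/-- The box limit of `⟨n_B⟩⁺_{Λ(L);β,h}` is `2^{-|B|} Σ_{D⊆B} ⟨σ_D⟩⁺_{β,h}` (`β, h ≥ 0`).
[cite: FriedliVelenik2017, Lemma 3.19 and Thm. 3.17] -/
theorem tendsto_isingExpect_plus_plusIndicator_field {β h : ℝ} (hβ : 0 ≤ β) (hh : 0 ≤ h) (B : Finset (Site d)) :
    Tendsto (fun L : ℕ => isingExpect (zdGraph d) (box d L) β h .plus (plusIndicator B)) atTop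
      (𝓝 (((2 : ℝ) ^ #B)⁻¹ * ∑ D ∈ B.powerset, plusCorr d β h D)) := by
  simp only [isingExpect_plusIndicator]
  exact (tendsto_finsetSum _ fun D _ => hasBoxLimit_isingCorr_plus_holds (d := d) hβ hh D).const_mul _

/-! ### Holley domination in the limit, at field `h ≥ 0` -/

/-- **`⟨n_A⟩^∅_{β,h} ≤ ⟨n_A⟩⁺_{β,h}`** (`β, h ≥ 0`; Holley domination of the nondecreasing `n_A` in finite volume,
`L → ∞`). [cite: FriedliVelenik2017, Thm. 3.28 (proof of 3 ⇒ 2)] -/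
theorem powersetSum_freeCorr_le_plusCorr_field {β h : ℝ} (hβ : 0 ≤ β) (hh : 0 ≤ h) (A : Finset (Site d)) :
    ((2 : ℝ) ^ #A)⁻¹ * ∑ D ∈ A.powerset, freeCorr d β h D ≤
      ((2 : ℝ) ^ #A)⁻¹ * ∑ D ∈ A.powerset, plusCorr d β h D :=
  le_of_tendsto_of_tendsto' (tendsto_isingExpect_free_plusIndicator_field hβ hh A)
    (tendsto_isingExpect_plus_plusIndicator_field hβ hh A) fun L =>
    isingExpect_free_le_plus_of_monotone (zdGraph d) (box d L) hβ h (plusIndicator_mono A)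
      (measurable_plusIndicator A)

/-- **`⟨Σ_{i∈A} n_i − n_A⟩^∅_{β,h} ≤ ⟨Σ_{i∈A} n_i − n_A⟩⁺_{β,h}`** (`β, h ≥ 0`; Holley domination of the nondecreasing
function of Friedli–Velenik Exercise 3.10, `L → ∞`). [cite: FriedliVelenik2017, Thm. 3.28 (proof of 3 ⇒ 2) and Exercise 3.10] -/
theorem sum_sub_powersetSum_freeCorr_le_plusCorr_field {β h : ℝ} (hβ : 0 ≤ β) (hh : 0 ≤ h) (A : Finset (Site d)) :
    ∑ i ∈ A, ((2 : ℝ) ^ #({i} : Finset (Site d)))⁻¹ *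
          ∑ D ∈ ({i} : Finset (Site d)).powerset, freeCorr d β h D -
        ((2 : ℝ) ^ #A)⁻¹ * ∑ D ∈ A.powerset, freeCorr d β h D ≤
      ∑ i ∈ A, ((2 : ℝ) ^ #({i} : Finset (Site d)))⁻¹ *
          ∑ D ∈ ({i} : Finset (Site d)).powerset, plusCorr d β h D -
        ((2 : ℝ) ^ #A)⁻¹ * ∑ D ∈ A.powerset, plusCorr d β h D := by
  have hmeas : Measurable fun σ : SpinConfig (Site d) =>
      ∑ i ∈ A, plusIndicator {i} σ - plusIndicator A σ :=
    (Finset.measurable_sum _ fun i _ => measurable_plusIndicator {i}).sub (measurable_plusIndicator A)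
  have tgf : Tendsto (fun L : ℕ => isingExpect (zdGraph d) (box d L) β h .free
      (fun σ => ∑ i ∈ A, plusIndicator {i} σ - plusIndicator A σ)) atTop
      (𝓝 (∑ i ∈ A, ((2 : ℝ) ^ #({i} : Finset (Site d)))⁻¹ *
          ∑ D ∈ ({i} : Finset (Site d)).powerset, freeCorr d β h D -
        ((2 : ℝ) ^ #A)⁻¹ * ∑ D ∈ A.powerset, freeCorr d β h D)) := by
    simp only [isingExpect_sum_plusIndicator_sub]
    exact (tendsto_finsetSum _ fun i _ => tendsto_isingExpect_free_plusIndicator_field hβ hh {i}).sub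
      (tendsto_isingExpect_free_plusIndicator_field hβ hh A)
  have tgp : Tendsto (fun L : ℕ => isingExpect (zdGraph d) (box d L) β h .plus
      (fun σ => ∑ i ∈ A, plusIndicator {i} σ - plusIndicator A σ)) atTop
      (𝓝 (∑ i ∈ A, ((2 : ℝ) ^ #({i} : Finset (Site d)))⁻¹ *
          ∑ D ∈ ({i} : Finset (Site d)).powerset, plusCorr d β h D -
        ((2 : ℝ) ^ #A)⁻¹ * ∑ D ∈ A.powerset, plusCorr d β h D)) := by
    simp only [isingExpect_sum_plusIndicator_sub]
    exact (tendsto_finsetSum _ fun i _ => tendsto_isingExpect_plus_plusIndicator_field hβ hh {i}).sub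
      (tendsto_isingExpect_plus_plusIndicator_field hβ hh A)
  exact le_of_tendsto_of_tendsto' tgf tgp fun L =>
    isingExpect_free_le_plus_of_monotone (zdGraph d) (box d L) hβ h (monotone_sum_plusIndicator_sub A) hmeas

/-! ### One-point agreement at every site, and the propagation to all spin products -/

/-- **`⟨σ_x⟩^∅_{β,h} = ⟨σ_x⟩⁺_{β,h}` for every site `x`** (`d ≥ 1`, `β ≥ 0`, `h > 0`): the tree's one-point agreement at
the origin (`freeCorr_eq_plusCorr_singleton_of_pos_holds`) transported by the translation invariance of both states.
[cite: FriedliVelenik2017, Thm. 3.25 (1) and Remark 3.41; Thm. 3.17, Exercise 3.16] -/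
theorem freeCorr_singleton_eq_plusCorr_singleton_of_pos (hd : 1 ≤ d) {β h : ℝ} (hβ : 0 ≤ β) (hh : 0 < h)
    (x : Site d) : freeCorr d β h {x} = plusCorr d β h {x} := by
  rw [← map_singleton_zero_shift x, freeCorr_shift (d := d) hβ hh.le, plusCorr_shift (d := d) hβ hh.le]
  exact freeCorr_eq_plusCorr_singleton_of_pos_holds hd hβ hh

/-- **`⟨n_A⟩^∅_{β,h} = ⟨n_A⟩⁺_{β,h}` for every finite `A`** (`d ≥ 1`, `β ≥ 0`, `h > 0`): `Σ_{D⊆A} ⟨σ_D⟩^∅_{β,h} =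
Σ_{D⊆A} ⟨σ_D⟩⁺_{β,h}` (the two Holley inequalities and the one-point agreement).
[cite: FriedliVelenik2017, Thm. 3.28 (proof of 3 ⇒ 2); LebowitzMartinlof1972, Theorem] -/
theorem powersetSum_freeCorr_eq_plusCorr_of_pos_field (hd : 1 ≤ d) {β h : ℝ} (hβ : 0 ≤ β) (hh : 0 < h)
    (A : Finset (Site d)) :
    ∑ D ∈ A.powerset, freeCorr d β h D = ∑ D ∈ A.powerset, plusCorr d β h D := by
  have l1 := powersetSum_freeCorr_le_plusCorr_field (d := d) hβ hh.le A
  have l2 := sum_sub_powersetSum_freeCorr_le_plusCorr_field (d := d) hβ hh.le A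
  -- on singletons the two states agree at `h > 0`
  have hs : ∀ i : Site d,
      ((2 : ℝ) ^ #({i} : Finset (Site d)))⁻¹ * ∑ D ∈ ({i} : Finset (Site d)).powerset, freeCorr d β h D =
        ((2 : ℝ) ^ #({i} : Finset (Site d)))⁻¹ * ∑ D ∈ ({i} : Finset (Site d)).powerset, plusCorr d β h D := by
    intro i
    rw [sum_powerset_singleton, sum_powerset_singleton, freeCorr_empty hβ hh.le, plusCorr_empty hβ hh.le,
      freeCorr_singleton_eq_plusCorr_singleton_of_pos hd hβ hh i]
  have hle : ((2 : ℝ) ^ #A)⁻¹ * ∑ D ∈ A.powerset, plusCorr d β h D ≤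
      ((2 : ℝ) ^ #A)⁻¹ * ∑ D ∈ A.powerset, freeCorr d β h D := by
    have : ∑ i ∈ A, ((2 : ℝ) ^ #({i} : Finset (Site d)))⁻¹ *
          ∑ D ∈ ({i} : Finset (Site d)).powerset, freeCorr d β h D =
        ∑ i ∈ A, ((2 : ℝ) ^ #({i} : Finset (Site d)))⁻¹ *
          ∑ D ∈ ({i} : Finset (Site d)).powerset, plusCorr d β h D :=
      Finset.sum_congr rfl fun i _ => hs i
    linarith
  have h2 : ((2 : ℝ) ^ #A)⁻¹ ≠ 0 := by positivity
  exact mul_left_cancel₀ h2 (le_antisymm l1 hle)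

/-- **IN A POSITIVE FIELD THE FREE AND PLUS STATES AGREE ON ALL SPIN PRODUCTS**: for the nearest-neighbour Ising model
on `ℤ^d`, `d ≥ 1`, `β ≥ 0`, `h > 0` and every finite `A ⊆ ℤ^d`, `⟨σ_A⟩^∅_{β,h} = ⟨σ_A⟩⁺_{β,h}` (Möbius inversion of
`powersetSum_freeCorr_eq_plusCorr_of_pos_field` over `A`). [cite: FriedliVelenik2017, Thm. 3.25 (1) and Thm. 3.28 (proof of 3 ⇒ 2); LebowitzMartinlof1972, Theorem] -/
theorem freeCorr_eq_plusCorr_of_pos_field (hd : 1 ≤ d) {β h : ℝ} (hβ : 0 ≤ β) (hh : 0 < h) (A : Finset (Site d)) :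
    freeCorr d β h A = plusCorr d β h A := by
  induction A using Finset.strongInduction with
  | H A ih =>
    have hA := powersetSum_freeCorr_eq_plusCorr_of_pos_field hd hβ hh A
    rw [← Finset.add_sum_erase _ _ (Finset.mem_powerset_self A),
      ← Finset.add_sum_erase _ _ (Finset.mem_powerset_self A)] at hA
    have hrest : ∑ D ∈ A.powerset.erase A, freeCorr d β h D = ∑ D ∈ A.powerset.erase A, plusCorr d β h D := by
      refine Finset.sum_congr rfl fun D hD => ?_
      rw [Finset.mem_erase, Finset.mem_powerset] at hD
      exact ih D (Finset.ssubset_iff_subset_ne.2 ⟨hD.2, hD.1⟩)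
    linarith

/-! ### Consequences: pair and truncated pair functions -/

/-- The free and plus two-point functions agree in a positive field: `⟨σ_xσ_y⟩^∅_{β,h} = ⟨σ_xσ_y⟩⁺_{β,h}` (`h > 0`).
[cite: FriedliVelenik2017, Thm. 3.25 (1)] -/
theorem freeCorr_pair_eq_plusCorr_pair_of_pos_field (hd : 1 ≤ d) {β h : ℝ} (hβ : 0 ≤ β) (hh : 0 < h)
    (x y : Site d) : freeCorr d β h {x, y} = plusCorr d β h {x, y} :=
  freeCorr_eq_plusCorr_of_pos_field hd hβ hh _

/-- The free and plus TRUNCATED pair functions agree in a positive field: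
`⟨σ_{{x}∆{y}}⟩^∅ − ⟨σ_x⟩^∅⟨σ_y⟩^∅ = ⟨σ_{{x}∆{y}}⟩⁺ − ⟨σ_x⟩⁺⟨σ_y⟩⁺` at `(β,h)`, `h > 0` (so the in-field susceptibilities of the
two states coincide). [cite: FriedliVelenik2017, Thm. 3.25 (1) and §3.7.4] -/
theorem freeTruncated_eq_plusTruncated_of_pos_field (hd : 1 ≤ d) {β h : ℝ} (hβ : 0 ≤ β) (hh : 0 < h)
    (x y : Site d) :
    freeCorr d β h ({x} ∆ {y}) - freeCorr d β h {x} * freeCorr d β h {y} =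
      plusCorr d β h ({x} ∆ {y}) - plusCorr d β h {x} * plusCorr d β h {y} := by
  simp only [freeCorr_eq_plusCorr_of_pos_field hd hβ hh]

end IsingSusceptibility

end Summit.CriticalPhenomena.PercolationContinuityZ3.Theorems.FK

end
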